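import Summits.QuantumFields.YangMills.Theorems.UnitScaleTiltProp7LinearCorrectorT3
import Summits.QuantumFields.YangMills.Theorems.UnitScaleTiltProp7TracePairing
import HarnessLib

/-!
# Route `UnitScaleTilt`, crux K1 «MinimiserStabilityRegPr» (stmt-QuantumFields-19200), route-R E′ path (α′), (E1-e): REALITY OF THE LINEAR CORRECTOR —
# `LinCorr` (✓ `Prop7LinearCorrectorT3.exists_linCorr(_T3)`) COMMUTES WITH EVERY FIBREWISE ADDITIVE MAP THAT COMMUTES WITH THE TRANSPORT `R(U)`; hence it maps HERMITIAN bond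
# fields to Hermitian site fields (`E = ᴴ`, unitary background) and TRACELESS ones to traceless ones (`E =` scalar part) — the `S`-invariance `hΦS` of the door
# ✓ `Prop7ExactCorrectorContractionGauge.exists_unique_exact_corrector_gauge_of_mapsTo` for `S = pinned ∧ Hermitian ∧ traceless`

Cell `ym3-torus`, width seat `ym3-torus-px13` (gen 3); «LINCORR-REAL» (offered 2026-08-28T21:59Z, the structural S-row left after LINCORR-T3 ✓p671932; (E1-e) lineage under ★p1 g15's
standing PASS).  THEOREMS ONLY (0 `def`, 0 `sorry`, 0 `instance`); `--supports stmt-QuantumFields-19200`, count-neutral.  YM₃ on T³ is a ladder rung (R3), not the Clay problem;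
nothing here claims the stub, the crux, d = 4 or the gap.

THE ONE IDEA.  If `E : M_N →+ M_N` satisfies `E (R(U_b) X) = R(U_b) (E X)` for every background bond unit, then `E∘` commutes with `D_U`, `D*_U`, `divB`, `Δ_U`, `Δ_U²` (pure algebra);
by UNIQUENESS of the pinned interpolant `I (E∘φ) = E∘(I φ)`, and by CHOICE-INDEPENDENCE of the corrector (`L A = φ − I φ` for EVERY potential, and `E∘φ` is a potential of `E∘A`)
`L (E∘A) = E∘(L A)`.  Instances: `E = conjTranspose` (commutes with `R(U)` for unitary `U`: `(UXU⁻¹)ᴴ = UXᴴU⁻¹`) and `E = π`, `π X := (tr X ∕ N)•1` (trace cyclicity, any units).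

WHAT IS PROVED (ns `…Theorems.Prop7LinearCorrectorReality`).
§1 GENERIC (`Site P j`, any units `U`, `E : M_N(ℂ) →+ M_N(ℂ)` with `hER`): `map_R_inv`, `covD_map`, `covDstar_map`, `divB_map`, `covLaplace_map`, `covBilaplace_map`,
★★ `interp_map` (`I (E∘φ) = E∘(I φ)` from the I-characterisation), ★★★ `linCorr_map` (`L (E∘A) = E∘(L A)` from the I- and L-characterisations + existence of potentials).
§2 THE TWO MAPS: (conjugate transpose: ✓ `Prop7CovariantCoercivity.conjTranspose_R`, `(R U X)ᴴ = R U Xᴴ` for unitary `U`), `scalarPart_R` (`π (R U X) = R U (π X)`, any `U`), `scalarPart_eq_zero_iff` (`π X = 0 ↔ tr X = 0`, `N ≠ 0`).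
§3 ★★★ `exists_linCorr_real_T3` — ✓ `exists_linCorr_T3`'s `I, L` (run `K` of a T³ family, any `SU(2)` background, any `k`) with TWO MORE conjuncts: `L` maps pointwise-Hermitian bond
fields to pointwise-Hermitian site fields, and pointwise-traceless to pointwise-traceless — with conjunct 3 (pinning) this is `L A ∈ S` for every Hermitian traceless `A`.
HONEST SCOPE.  Algebra over landed files; no analytic row.

References: T. Bałaban, CMP 99 (1985) 75–102 [Balaban1985RegularSpaces] ((1.14) p.78); CMP 102 (1985) 277–309 [Balaban1985Variational] (Prop. 7 p.299);
CMP 99 (1985) 389–434 [Balaban1985BackgroundPropagators] ((3.3) p.390, (3.8) p.392).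
-/

set_option autoImplicit false

noncomputable section

open scoped BigOperators Matrix.Norms.L2Operator Matrix

namespace Summit.QuantumFields.YangMills.Theorems.Prop7LinearCorrectorReality

open Literature.MathematicalPhysics.QuantumFieldTheory.Balaban1983to89
open B9Eq39Adjoint (R R_def R_add R_sub R_inv_R R_R_inv covD covDstar divB)
open B9TorusCalculus (torusT)
open Summit.QuantumFields.YangMills.Theorems.Prop7LinearCorrectorT3 (exists_potential exists_linCorr exists_linCorr_T3)

variable {P : Params} {j : ℕ} {N : ℕ}

/-! ## §1 A fibrewise additive map commuting with the transport commutes with everything -/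

section Generic

variable (U : Fin P.d → Site P j → (Matrix (Fin N) (Fin N) ℂ)ˣ) (E : Matrix (Fin N) (Fin N) ℂ →+ Matrix (Fin N) (Fin N) ℂ)
  (hER : ∀ (μ : Fin P.d) (x : Site P j) (X : Matrix (Fin N) (Fin N) ℂ), E (R (U μ x) X) = R (U μ x) (E X))

include hER in
/-- `E` commutes with the inverse transports too: `E (R(U⁻¹) X) = R(U⁻¹)(E X)`. [cite: Balaban1985BackgroundPropagators, (3.5) p.391] -/
theorem map_R_inv (μ : Fin P.d) (x : Site P j) (X : Matrix (Fin N) (Fin N) ℂ) : E (R (U μ x)⁻¹ X) = R (U μ x)⁻¹ (E X) := by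
  have h := hER μ x (R (U μ x)⁻¹ X)
  rw [R_R_inv] at h
  rw [h, R_inv_R]

include hER in
/-- `E∘` commutes with the covariant difference: `D_U(E∘f) = E∘(D_Uf)`. [cite: Balaban1985BackgroundPropagators, (3.3) p.390] -/
theorem covD_map (μ : Fin P.d) (f : Site P j → Matrix (Fin N) (Fin N) ℂ) (x : Site P j) :
    covD (torusT P j) U μ (fun y => E (f y)) x = E (covD (torusT P j) U μ f x) := by
  simp only [covD, map_sub, hER]

include hER in
/-- `E∘` commutes with the reversed-bond difference `D*_{U,μ}`. [cite: Balaban1985BackgroundPropagators, (3.8) p.392] -/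
theorem covDstar_map (μ : Fin P.d) (G : Site P j → Matrix (Fin N) (Fin N) ℂ) (x : Site P j) :
    covDstar (torusT P j) U μ (fun y => E (G y)) x = E (covDstar (torusT P j) U μ G x) := by
  simp only [covDstar, map_sub, map_R_inv U E hER]

include hER in
/-- `E∘` commutes with the site divergence: `divB(E∘A) = E∘(divB A)`. [cite: Balaban1985BackgroundPropagators, (3.8) p.392] -/
theorem divB_map (A : Fin P.d → Site P j → Matrix (Fin N) (Fin N) ℂ) (x : Site P j) :
    divB (torusT P j) U (fun μ y => E (A μ y)) x = E (divB (torusT P j) U A x) := by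
  simp only [divB, map_sum]
  refine Finset.sum_congr rfl fun μ _ => ?_
  exact covDstar_map U E hER μ (A μ) x

include hER in
/-- `E∘` commutes with the covariant Laplacian `Δ_U = divB ∘ covD`. [cite: Balaban1985BackgroundPropagators, (3.8) p.392] -/
theorem covLaplace_map (f : Site P j → Matrix (Fin N) (Fin N) ℂ) (x : Site P j) :
    divB (torusT P j) U (fun μ => covD (torusT P j) U μ (fun y => E (f y))) x = E (divB (torusT P j) U (fun μ => covD (torusT P j) U μ f) x) := by
  have e : (fun μ => covD (torusT P j) U μ (fun y => E (f y))) = fun μ y => E (covD (torusT P j) U μ f y) := by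
    funext μ y; exact covD_map U E hER μ f y
  rw [e, divB_map U E hER]

include hER in
/-- `E∘` commutes with `Δ_U²`. [cite: Balaban1985BackgroundPropagators, (3.8) p.392] -/
theorem covBilaplace_map (f : Site P j → Matrix (Fin N) (Fin N) ℂ) (x : Site P j) :
    divB (torusT P j) U (fun μ => covD (torusT P j) U μ (fun y => divB (torusT P j) U (fun ν => covD (torusT P j) U ν (fun w => E (f w))) y)) x
      = E (divB (torusT P j) U (fun μ => covD (torusT P j) U μ (fun y => divB (torusT P j) U (fun ν => covD (torusT P j) U ν f) y)) x) := by
  have e : (fun y => divB (torusT P j) U (fun ν => covD (torusT P j) U ν (fun w => E (f w))) y)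
      = fun y => E (divB (torusT P j) U (fun ν => covD (torusT P j) U ν f) y) := by
    funext y; exact covLaplace_map U E hER f y
  rw [e, covLaplace_map U E hER]

include hER in
/-- ★★ **THE INTERPOLANT IS `E`-EQUIVARIANT**: if `I φ` is characterised as THE field equal to `φ` on `C` with `Δ_U²(Iφ) = 0` off `C`, then `I (E∘φ) = E∘(I φ)`.
[cite: Balaban1985RegularSpaces, (1.14) p.78] -/
theorem interp_map (C : Finset (Site P j)) (I : (Site P j → Matrix (Fin N) (Fin N) ℂ) →+ (Site P j → Matrix (Fin N) (Fin N) ℂ))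
    (hI : ∀ φ, ((∀ y ∈ C, I φ y = φ y) ∧ ∀ z ∉ C, divB (torusT P j) U (fun μ => covD (torusT P j) U μ
          (fun y => divB (torusT P j) U (fun ν => covD (torusT P j) U ν (I φ)) y)) z = 0) ∧
        ∀ χ, ((∀ y ∈ C, χ y = φ y) ∧ ∀ z ∉ C, divB (torusT P j) U (fun μ => covD (torusT P j) U μ
          (fun y => divB (torusT P j) U (fun ν => covD (torusT P j) U ν χ) y)) z = 0) → χ = I φ)
    (φ : Site P j → Matrix (Fin N) (Fin N) ℂ) :
    I (fun y => E (φ y)) = fun y => E (I φ y) := by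
  symm
  refine (hI (fun y => E (φ y))).2 (fun y => E (I φ y)) ⟨fun y hy => by rw [(hI φ).1.1 y hy], fun z hz => ?_⟩
  rw [covBilaplace_map U E hER (I φ) z, (hI φ).1.2 z hz, map_zero]

include hER in
/-- ★★★ **THE LINEAR CORRECTOR IS `E`-EQUIVARIANT**: with the I- and L-characterisations of ✓ `exists_linCorr` and potentials for every `A`, `L (E∘A) = E∘(L A)`.
[cite: Balaban1985Variational, Prop. 7 p.299] -/
theorem linCorr_map (C : Finset (Site P j)) (I : (Site P j → Matrix (Fin N) (Fin N) ℂ) →+ (Site P j → Matrix (Fin N) (Fin N) ℂ))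
    (L : (Fin P.d → Site P j → Matrix (Fin N) (Fin N) ℂ) →+ (Site P j → Matrix (Fin N) (Fin N) ℂ))
    (hI : ∀ φ, ((∀ y ∈ C, I φ y = φ y) ∧ ∀ z ∉ C, divB (torusT P j) U (fun μ => covD (torusT P j) U μ
          (fun y => divB (torusT P j) U (fun ν => covD (torusT P j) U ν (I φ)) y)) z = 0) ∧
        ∀ χ, ((∀ y ∈ C, χ y = φ y) ∧ ∀ z ∉ C, divB (torusT P j) U (fun μ => covD (torusT P j) U μ
          (fun y => divB (torusT P j) U (fun ν => covD (torusT P j) U ν χ) y)) z = 0) → χ = I φ)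
    (hL : ∀ A φ, (∀ x, divB (torusT P j) U (fun μ => covD (torusT P j) U μ φ) x = divB (torusT P j) U A x) → L A = φ - I φ)
    (hLex : ∀ A, ∃ φ, (∀ x, divB (torusT P j) U (fun μ => covD (torusT P j) U μ φ) x = divB (torusT P j) U A x) ∧ L A = φ - I φ)
    (A : Fin P.d → Site P j → Matrix (Fin N) (Fin N) ℂ) :
    L (fun μ y => E (A μ y)) = fun y => E (L A y) := by
  obtain ⟨φ, hφ, hLA⟩ := hLex A
  -- `E∘φ` is a potential of `E∘A`
  have hφE : ∀ x, divB (torusT P j) U (fun μ => covD (torusT P j) U μ (fun y => E (φ y))) x = divB (torusT P j) U (fun μ y => E (A μ y)) x := by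
    intro x
    rw [covLaplace_map U E hER φ x, hφ x, divB_map U E hER A x]
  rw [hL _ _ hφE, interp_map U E hER C I hI φ, hLA]
  funext y
  simp only [Pi.sub_apply, map_sub]

end Generic

/-! ## §2 The two maps: conjugate transpose (unitary background) and the scalar part (any background) -/

/-- `π (R U X) = R U (π X)` for the scalar part `π X = (tr X ∕ N)•1` and ANY unit `U` (trace cyclicity; `R U (c•1) = c•1`). [cite: Balaban1985BackgroundPropagators, (3.5) p.391] -/
theorem scalarPart_R (U : (Matrix (Fin N) (Fin N) ℂ)ˣ) (X : Matrix (Fin N) (Fin N) ℂ) :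
    ((R U X).trace / (N : ℂ)) • (1 : Matrix (Fin N) (Fin N) ℂ) = R U ((X.trace / (N : ℂ)) • (1 : Matrix (Fin N) (Fin N) ℂ)) := by
  have htr : (R U X).trace = X.trace := by
    rw [R_def, Matrix.trace_mul_cycle, Units.inv_mul, Matrix.one_mul]
  rw [htr, R_def, Matrix.mul_smul, Matrix.mul_one, Matrix.smul_mul, Units.mul_inv]

/-- `π X = 0 ↔ tr X = 0` (`N ≠ 0`). [folklore] -/
theorem scalarPart_eq_zero_iff [NeZero N] (X : Matrix (Fin N) (Fin N) ℂ) :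
    (X.trace / (N : ℂ)) • (1 : Matrix (Fin N) (Fin N) ℂ) = 0 ↔ X.trace = 0 := by
  have hN : (N : ℂ) ≠ 0 := Nat.cast_ne_zero.mpr (NeZero.ne N)
  have h1 : (1 : Matrix (Fin N) (Fin N) ℂ) ≠ 0 := one_ne_zero
  rw [smul_eq_zero, or_iff_left h1, div_eq_zero_iff, or_iff_left hN]

/-! ## §3 The T³ reading: `LinCorr` preserves Hermiticity and tracelessness -/

section T3

open Literature.MathematicalPhysics.QuantumFieldTheory.Balaban1983to89.T3ContinuumYM3Torus
open B10Eq27TorusAxialLog (unitsField toUField)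
open B15DeterminingSets (embIter)
open Summit.QuantumFields.YangMills.Theorems.Prop7CovHodgeSplit (unitsField_toUField_mem_unitary)
open Summit.QuantumFields.YangMills.Theorems.Prop7PinnedHarmonicMass (centres_homogeneous)

/-- ★★★ **`LinCorr` ON THE T³ CARRIER, WITH REALITY** (run `K` of a T³ family, ANY `SU(2)` background `W`, any `k`; `𝒰 := fun κ z => unitsField (toUField W) ⟨z, κ⟩`): the four conjuncts of
✓ `exists_linCorr_T3` AND (e) `A` pointwise Hermitian ⇒ `L A` pointwise Hermitian, (f) `A` pointwise traceless ⇒ `L A` pointwise traceless — i.e. `L A ∈ S := pinned ∧ Herm ∧ tr0`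
for Hermitian traceless `A` (the structural half of `hΦS` in ✓ `exists_unique_exact_corrector_gauge_of_mapsTo`).
[cite: Balaban1985Variational, Prop. 7 p.299; Balaban1985RegularSpaces, (1.14) p.78; Balaban1985BackgroundPropagators, (3.8) p.392] -/
theorem exists_linCorr_real_T3 (F : T3Family) (K k : ℕ) (W : GaugeField (F.P K) 0 (Matrix.specialUnitaryGroup (Fin 2) ℂ)) :
    ∃ (I : (Site (F.P K) 0 → Matrix (Fin 2) (Fin 2) ℂ) →+ (Site (F.P K) 0 → Matrix (Fin 2) (Fin 2) ℂ))
      (L : (Fin (F.P K).d → Site (F.P K) 0 → Matrix (Fin 2) (Fin 2) ℂ) →+ (Site (F.P K) 0 → Matrix (Fin 2) (Fin 2) ℂ)),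
      (∀ φ, ((∀ y : Site (F.P K) k, I φ (embIter k y) = φ (embIter k y)) ∧
          ∀ x : Site (F.P K) 0, x ∉ Set.range (embIter k) →
            divB (torusT (F.P K) 0) (fun κ z => unitsField (toUField W) ⟨z, κ⟩)
              (fun μ => covD (torusT (F.P K) 0) (fun κ z => unitsField (toUField W) ⟨z, κ⟩) μ
                (fun y => divB (torusT (F.P K) 0) (fun κ z => unitsField (toUField W) ⟨z, κ⟩)
                  (fun ν => covD (torusT (F.P K) 0) (fun κ z => unitsField (toUField W) ⟨z, κ⟩) ν (I φ)) y)) x = 0) ∧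
        ∀ χ, (∀ y : Site (F.P K) k, χ (embIter k y) = φ (embIter k y)) →
          (∀ x : Site (F.P K) 0, x ∉ Set.range (embIter k) →
            divB (torusT (F.P K) 0) (fun κ z => unitsField (toUField W) ⟨z, κ⟩)
              (fun μ => covD (torusT (F.P K) 0) (fun κ z => unitsField (toUField W) ⟨z, κ⟩) μ
                (fun y => divB (torusT (F.P K) 0) (fun κ z => unitsField (toUField W) ⟨z, κ⟩)
                  (fun ν => covD (torusT (F.P K) 0) (fun κ z => unitsField (toUField W) ⟨z, κ⟩) ν χ) y)) x = 0) → χ = I φ) ∧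
      (∀ A φ, (∀ x, divB (torusT (F.P K) 0) (fun κ z => unitsField (toUField W) ⟨z, κ⟩)
            (fun μ => covD (torusT (F.P K) 0) (fun κ z => unitsField (toUField W) ⟨z, κ⟩) μ φ) x
          = divB (torusT (F.P K) 0) (fun κ z => unitsField (toUField W) ⟨z, κ⟩) A x) → L A = φ - I φ) ∧
      (∀ (A) (y : Site (F.P K) k), L A (embIter k y) = 0) ∧
      (∀ A, ∃ φ, (∀ x, divB (torusT (F.P K) 0) (fun κ z => unitsField (toUField W) ⟨z, κ⟩)
            (fun μ => covD (torusT (F.P K) 0) (fun κ z => unitsField (toUField W) ⟨z, κ⟩) μ φ) x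
          = divB (torusT (F.P K) 0) (fun κ z => unitsField (toUField W) ⟨z, κ⟩) A x) ∧ L A = φ - I φ) ∧
      (∀ A, (∀ μ x, (A μ x)ᴴ = A μ x) → ∀ x, (L A x)ᴴ = L A x) ∧
      (∀ A, (∀ μ x, (A μ x).trace = 0) → ∀ x, (L A x).trace = 0) := by
  classical
  set U : Fin (F.P K).d → Site (F.P K) 0 → (Matrix (Fin 2) (Fin 2) ℂ)ˣ := fun κ z => unitsField (toUField W) ⟨z, κ⟩ with hUdef
  set C : Finset (Site (F.P K) 0) := (Finset.univ : Finset (Site (F.P K) k)).image (embIter k) with hCdef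
  have hCne : C.Nonempty := ⟨embIter k default, Finset.mem_image_of_mem _ (Finset.mem_univ _)⟩
  have hU : ∀ κ (z : Site (F.P K) 0), (U κ z : Matrix (Fin 2) (Fin 2) ℂ) ∈ unitary (Matrix (Fin 2) (Fin 2) ℂ) :=
    fun κ z => unitsField_toUField_mem_unitary W κ z
  have hmemC : ∀ x : Site (F.P K) 0, x ∈ C ↔ x ∈ Set.range (embIter k) := by
    intro x
    rw [hCdef, Finset.mem_image, Set.mem_range]
    exact ⟨fun ⟨y, _, hy⟩ => ⟨y, hy⟩, fun ⟨y, hy⟩ => ⟨y, Finset.mem_univ _, hy⟩⟩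
  have hembC : ∀ y : Site (F.P K) k, embIter k y ∈ C := fun y => (hmemC _).2 ⟨y, rfl⟩
  obtain ⟨I, L, hI, hL, hLC, hLex⟩ := exists_linCorr (U := U) hU C hCne (centres_homogeneous k)
  -- the two equivariances
  let Estar : Matrix (Fin 2) (Fin 2) ℂ →+ Matrix (Fin 2) (Fin 2) ℂ := (Matrix.conjTransposeAddEquiv (Fin 2) (Fin 2) ℂ).toAddMonoidHom
  have hEstar : ∀ X, Estar X = Xᴴ := fun X => rfl
  have hERstar : ∀ (μ : Fin (F.P K).d) (x : Site (F.P K) 0) (X : Matrix (Fin 2) (Fin 2) ℂ), Estar (R (U μ x) X) = R (U μ x) (Estar X) := by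
    intro μ x X
    rw [hEstar, hEstar]
    exact Prop7CovariantCoercivity.conjTranspose_R (hU μ x) X
  let Epi : Matrix (Fin 2) (Fin 2) ℂ →+ Matrix (Fin 2) (Fin 2) ℂ :=
    AddMonoidHom.mk' (fun X => (X.trace / ((2 : ℕ) : ℂ)) • (1 : Matrix (Fin 2) (Fin 2) ℂ)) (by
      intro X Y
      rw [Matrix.trace_add, add_div, add_smul])
  have hEpi : ∀ X, Epi X = (X.trace / ((2 : ℕ) : ℂ)) • (1 : Matrix (Fin 2) (Fin 2) ℂ) := fun X => rfl
  have hERpi : ∀ (μ : Fin (F.P K).d) (x : Site (F.P K) 0) (X : Matrix (Fin 2) (Fin 2) ℂ), Epi (R (U μ x) X) = R (U μ x) (Epi X) := by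
    intro μ x X
    rw [hEpi, hEpi]
    exact scalarPart_R (U μ x) X
  have hstar : ∀ A, L (fun μ y => Estar (A μ y)) = fun y => Estar (L A y) := linCorr_map U Estar hERstar C I L hI hL hLex
  have hpi : ∀ A, L (fun μ y => Epi (A μ y)) = fun y => Epi (L A y) := linCorr_map U Epi hERpi C I L hI hL hLex
  refine ⟨I, L, fun φ => ⟨⟨fun y => (hI φ).1.1 _ (hembC y), fun x hx => (hI φ).1.2 x fun hxC => hx ((hmemC x).1 hxC)⟩, fun χ h0 hbi => ?_⟩,
    hL, fun A y => hLC A _ (hembC y), hLex, fun A hA x => ?_, fun A hA x => ?_⟩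
  · refine (hI φ).2 χ ⟨fun y hy => ?_, fun z hz => hbi z fun hzr => hz ((hmemC z).2 hzr)⟩
    obtain ⟨y', hy'⟩ := (hmemC y).1 hy
    rw [← hy']
    exact h0 y'
  · -- Hermitian in, Hermitian out
    have hAE : (fun μ y => Estar (A μ y)) = A := by
      funext μ y; rw [hEstar]; exact hA μ y
    have h := congrFun (hstar A) x
    rw [hAE, hEstar] at h
    exact h.symm
  · -- traceless in, traceless out
    have hAE : (fun μ y => Epi (A μ y)) = 0 := by
      funext μ y; rw [hEpi, Pi.zero_apply, Pi.zero_apply, hA μ y, zero_div, zero_smul]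
    have h := congrFun (hpi A) x
    rw [hAE, map_zero, Pi.zero_apply, hEpi] at h
    exact (scalarPart_eq_zero_iff (L A x)).1 h.symm

end T3

end Summit.QuantumFields.YangMills.Theorems.Prop7LinearCorrectorReality

end
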